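import Mathlib
import Summits.Ventures.PercRepro2.Defs
import Summits.Ventures.PercRepro2.Independence
import Summits.Ventures.PercRepro2.Harris
import Summits.Ventures.PercRepro2.Graph
import Summits.Ventures.PercRepro2.Exploration
import Summits.Ventures.PercRepro2.Induced

/-!
# The first rung (R1) of the edge-deletion-monotonicity ladder (blind cell PercRepro2, typer-1;
mine-c g2 `MINE-C.md` §9.6 (b)–(c), post 2026-08-23T08:38:07Z; lead g10 ask 08:31:51Z)

Under `Q = {a₁ ↮ a₂}` with the masses `A = P(Q, b ∈ C(a₁), o ∈ C(a₂))`, `F = P(Q, b ∈ C(a₁))`,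
`G = P(Q, o ∈ C(a₂))`, `P = P(Q)`, and the pinned weights `p[e ↦ 1]` (index `1`, `e` open) and
`p[e ↦ 0]` (index `0`, `e` closed):

* **`R1`** (the cross-cluster first rung): `A₁ P₀² + F₀ G₀ P₁ ≤ P₀ (F₁ G₀ + F₀ G₁)` — the cleared form
  of `E_{μ₁}[(1_{bL} − μ₀(bL))(1_{oH} − μ₀(oH))] ≤ 0`; **`R1Same`** (the same-cluster twin, `o ∈ C(a₁)`):
  the reverse inequality; closures `R1_all` (labelled instances, every edge) and `R1Same_all`;
* the Bernstein bookkeeping along the edge line `t ↦ p[e ↦ t]`: `X t = P_t A_t − F_t G_t` is the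
  quadratic `(1−t)² c₀ + t(1−t)·(2c₁) + t² c₂` (`X_bernstein`, from the pinning identity `prob_eq_pin`),
  and **`R1_iff_bernstein`**: `R1 ↔ P₀ · (2c₁) ≤ P₁ · c₀` (the mixed base is at most the closed–closed
  base per unit `Q`-mass — mine-c's "quantitative CrossBase");
* `R1_iff_cov` (the covariance form at `P₀ P₁ ≠ 0`, with `μ_i` the conditional laws).

Census (mine-c, exact): `R1` 0 / 21,060 and `R1Same` 0 / 21,060 at `n = 5` (all graphs, 3 weight
vectors, every edge, every labelled marking); the mass-free variants fail. Statement only.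
-/

namespace Summit.Ventures.PercRepro2

namespace R1Rung

section Defs

variable {V : Type*} {E : Type*} [Fintype E] [DecidableEq E] {R : Type*} [CommRing R]

/-- `A = P(Q, b ∈ C(a₁), o ∈ C(a₂))` (cross clusters). -/
noncomputable def massA (p : E → R) (ends : E → Sym2 V) (o a₁ a₂ b : V) : R :=
  prob p (avoidAll ends a₂ {a₁} ∩ (connEvent ends a₁ b ∩ connEvent ends a₂ o))

/-- `A^s = P(Q, b ∈ C(a₁), o ∈ C(a₁))` (same cluster). -/
noncomputable def massAs (p : E → R) (ends : E → Sym2 V) (o a₁ a₂ b : V) : R :=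
  prob p (avoidAll ends a₂ {a₁} ∩ (connEvent ends a₁ b ∩ connEvent ends a₁ o))

/-- `F = P(Q, b ∈ C(a₁))`. -/
noncomputable def massF (p : E → R) (ends : E → Sym2 V) (a₁ a₂ b : V) : R :=
  prob p (avoidAll ends a₂ {a₁} ∩ connEvent ends a₁ b)

/-- `G = P(Q, o ∈ C(a₂))`. -/
noncomputable def massG (p : E → R) (ends : E → Sym2 V) (o a₁ a₂ : V) : R :=
  prob p (avoidAll ends a₂ {a₁} ∩ connEvent ends a₂ o)

/-- `F^s = P(Q, o ∈ C(a₁))`. -/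
noncomputable def massFs (p : E → R) (ends : E → Sym2 V) (o a₁ a₂ : V) : R :=
  prob p (avoidAll ends a₂ {a₁} ∩ connEvent ends a₁ o)

/-- `P = P(Q)`. -/
noncomputable def massQ (p : E → R) (ends : E → Sym2 V) (a₁ a₂ : V) : R :=
  prob p (avoidAll ends a₂ {a₁})

/-- The closed–closed Bernstein base `c₀ = P₀ A₀ − F₀ G₀`. -/
noncomputable def c0 (p : E → R) (ends : E → Sym2 V) (e : E) (o a₁ a₂ b : V) : R :=
  massQ (Function.update p e 0) ends a₁ a₂ * massA (Function.update p e 0) ends o a₁ a₂ b -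
    massF (Function.update p e 0) ends a₁ a₂ b * massG (Function.update p e 0) ends o a₁ a₂

/-- Twice the mixed Bernstein base, `2c₁ = P₀ A₁ + P₁ A₀ − F₀ G₁ − F₁ G₀`. -/
noncomputable def c1twice (p : E → R) (ends : E → Sym2 V) (e : E) (o a₁ a₂ b : V) : R :=
  massQ (Function.update p e 0) ends a₁ a₂ * massA (Function.update p e 1) ends o a₁ a₂ b +
    massQ (Function.update p e 1) ends a₁ a₂ * massA (Function.update p e 0) ends o a₁ a₂ b -
    massF (Function.update p e 0) ends a₁ a₂ b * massG (Function.update p e 1) ends o a₁ a₂ -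
    massF (Function.update p e 1) ends a₁ a₂ b * massG (Function.update p e 0) ends o a₁ a₂

/-- The open–open Bernstein base `c₂ = P₁ A₁ − F₁ G₁`. -/
noncomputable def c2 (p : E → R) (ends : E → Sym2 V) (e : E) (o a₁ a₂ b : V) : R :=
  massQ (Function.update p e 1) ends a₁ a₂ * massA (Function.update p e 1) ends o a₁ a₂ b -
    massF (Function.update p e 1) ends a₁ a₂ b * massG (Function.update p e 1) ends o a₁ a₂

/-- The BHK 1.1 slack `X(p) = P(Q) · P(Q, bL, oH) − P(Q, bL) · P(Q, oH)` (`≤ 0` by BHK). -/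
noncomputable def X (p : E → R) (ends : E → Sym2 V) (o a₁ a₂ b : V) : R :=
  massQ p ends a₁ a₂ * massA p ends o a₁ a₂ b - massF p ends a₁ a₂ b * massG p ends o a₁ a₂

end Defs

section Rows

variable {V : Type*} {E : Type*} [Fintype E] [DecidableEq E] {R : Type*} [Field R] [LinearOrder R]

/-- **(R1)** at the edge `e` (mine-c §9.6 (b)): `A₁ P₀² + F₀ G₀ P₁ ≤ P₀ (F₁ G₀ + F₀ G₁)`. -/
def R1 (p : E → R) (ends : E → Sym2 V) (e : E) (o a₁ a₂ b : V) : Prop :=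
  massA (Function.update p e 1) ends o a₁ a₂ b * massQ (Function.update p e 0) ends a₁ a₂ ^ 2 +
      massF (Function.update p e 0) ends a₁ a₂ b * massG (Function.update p e 0) ends o a₁ a₂ *
        massQ (Function.update p e 1) ends a₁ a₂ ≤
    massQ (Function.update p e 0) ends a₁ a₂ *
      (massF (Function.update p e 1) ends a₁ a₂ b * massG (Function.update p e 0) ends o a₁ a₂ +
        massF (Function.update p e 0) ends a₁ a₂ b * massG (Function.update p e 1) ends o a₁ a₂)

/-- **(R1-same)** at the edge `e`: `A^s₁ P₀² + F^s₀ F₀ P₁ ≥ P₀ (F^s₁ F₀ + F^s₀ F₁)`. -/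
def R1Same (p : E → R) (ends : E → Sym2 V) (e : E) (o a₁ a₂ b : V) : Prop :=
  massQ (Function.update p e 0) ends a₁ a₂ *
      (massFs (Function.update p e 1) ends o a₁ a₂ * massF (Function.update p e 0) ends a₁ a₂ b +
        massFs (Function.update p e 0) ends o a₁ a₂ * massF (Function.update p e 1) ends a₁ a₂ b) ≤
    massAs (Function.update p e 1) ends o a₁ a₂ b * massQ (Function.update p e 0) ends a₁ a₂ ^ 2 +
      massFs (Function.update p e 0) ends o a₁ a₂ * massF (Function.update p e 0) ends a₁ a₂ b *
        massQ (Function.update p e 1) ends a₁ a₂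

end Rows

section Closure

variable (R : Type*) [Field R] [LinearOrder R] [IsStrictOrderedRing R]

/-- Row (R1) over all finite graphs, admissible weights, edges and labelled markings. -/
def R1_all : Prop :=
  ∀ (V E : Type) [Fintype V] [DecidableEq V] [Fintype E] [DecidableEq E]
    (ends : E → Sym2 V) (p : E → R), IsProbVec p →
    ∀ (e : E) (o a₁ a₂ b : V), a₁ ≠ a₂ → o ≠ a₁ → o ≠ a₂ → o ≠ b → b ≠ a₁ → b ≠ a₂ →
      prob p (connEvent ends a₁ b) ≤ prob p (connEvent ends a₂ b) →
      R1 p ends e o a₁ a₂ b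

/-- Row (R1-same) over all finite graphs, admissible weights, edges and labelled markings. -/
def R1Same_all : Prop :=
  ∀ (V E : Type) [Fintype V] [DecidableEq V] [Fintype E] [DecidableEq E]
    (ends : E → Sym2 V) (p : E → R), IsProbVec p →
    ∀ (e : E) (o a₁ a₂ b : V), a₁ ≠ a₂ → o ≠ a₁ → o ≠ a₂ → o ≠ b → b ≠ a₁ → b ≠ a₂ →
      prob p (connEvent ends a₁ b) ≤ prob p (connEvent ends a₂ b) →
      R1Same p ends e o a₁ a₂ b

end Closure

/-! ## Bernstein bookkeeping along the edge line -/

section Bernstein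

variable {V : Type*} {E : Type*} [Fintype E] [DecidableEq E] {R : Type*} [CommRing R]

/-- A probability at the weight `p[e ↦ t]` is the mixture `t · (·)₁ + (1 − t) · (·)₀`. -/
lemma prob_update_eq_mix (p : E → R) (A : Set (Config E)) (e : E) (t : R) :
    prob (Function.update p e t) A =
      t * prob (Function.update p e 1) A + (1 - t) * prob (Function.update p e 0) A := by
  rw [prob_eq_pin (Function.update p e t) A e, Function.update_idem, Function.update_idem,
    Function.update_self]

/-- `X` along the edge line is the quadratic `(1−t)² c₀ + t(1−t)·(2c₁) + t² c₂`. -/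
theorem X_bernstein (p : E → R) (ends : E → Sym2 V) (e : E) (o a₁ a₂ b : V) (t : R) :
    X (Function.update p e t) ends o a₁ a₂ b =
      (1 - t) ^ 2 * c0 p ends e o a₁ a₂ b + t * (1 - t) * c1twice p ends e o a₁ a₂ b +
        t ^ 2 * c2 p ends e o a₁ a₂ b := by
  unfold X c0 c1twice c2 massQ massA massF massG
  rw [prob_update_eq_mix p _ e t, prob_update_eq_mix p _ e t, prob_update_eq_mix p _ e t,
    prob_update_eq_mix p _ e t]
  ring

/-- `c₀`, `c₂` are the values of `X` at the pinned weights. -/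
lemma c0_eq_X (p : E → R) (ends : E → Sym2 V) (e : E) (o a₁ a₂ b : V) :
    c0 p ends e o a₁ a₂ b = X (Function.update p e 0) ends o a₁ a₂ b := rfl

/-- `c₂ = X(p[e ↦ 1])`. -/
lemma c2_eq_X (p : E → R) (ends : E → Sym2 V) (e : E) (o a₁ a₂ b : V) :
    c2 p ends e o a₁ a₂ b = X (Function.update p e 1) ends o a₁ a₂ b := rfl

end Bernstein

section Equivalences

variable {V : Type*} {E : Type*} [Fintype E] [DecidableEq E] {R : Type*} [Field R] [LinearOrder R]
  [IsStrictOrderedRing R]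

omit [LinearOrder R] [IsStrictOrderedRing R] in
/-- The difference of the two sides of (R1) is `P₁ · c₀ − P₀ · (2c₁)`. -/
lemma R1_slack_eq (p : E → R) (ends : E → Sym2 V) (e : E) (o a₁ a₂ b : V) :
    massQ (Function.update p e 0) ends a₁ a₂ *
        (massF (Function.update p e 1) ends a₁ a₂ b * massG (Function.update p e 0) ends o a₁ a₂ +
          massF (Function.update p e 0) ends a₁ a₂ b * massG (Function.update p e 1) ends o a₁ a₂) -
      (massA (Function.update p e 1) ends o a₁ a₂ b * massQ (Function.update p e 0) ends a₁ a₂ ^ 2 +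
        massF (Function.update p e 0) ends a₁ a₂ b * massG (Function.update p e 0) ends o a₁ a₂ *
          massQ (Function.update p e 1) ends a₁ a₂) =
      massQ (Function.update p e 1) ends a₁ a₂ * c0 p ends e o a₁ a₂ b -
        massQ (Function.update p e 0) ends a₁ a₂ * c1twice p ends e o a₁ a₂ b := by
  unfold c0 c1twice
  ring

/-- **(R1) in Bernstein form**: `P₀ · (2c₁) ≤ P₁ · c₀` — the mixed base of `X` along the edge line
is at most the closed–closed base, per unit `Q`-mass. -/
theorem R1_iff_bernstein (p : E → R) (ends : E → Sym2 V) (e : E) (o a₁ a₂ b : V) :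
    R1 p ends e o a₁ a₂ b ↔
      massQ (Function.update p e 0) ends a₁ a₂ * c1twice p ends e o a₁ a₂ b ≤
        massQ (Function.update p e 1) ends a₁ a₂ * c0 p ends e o a₁ a₂ b := by
  unfold R1
  rw [← sub_nonneg, R1_slack_eq, sub_nonneg]

/-- **(R1) in covariance form**: at `P₀ P₁ ≠ 0`,
`E_{μ₁}[(1_{bL} − μ₀(bL)) (1_{oH} − μ₀(oH))] ≤ 0`, written with the conditional masses
`μ₁(bL, oH) = A₁/P₁`, `μ₀(bL) = F₀/P₀`, `μ₀(oH) = G₀/P₀`, `μ₁(bL) = F₁/P₁`, `μ₁(oH) = G₁/P₁`. -/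
theorem R1_iff_cov (p : E → R) (ends : E → Sym2 V) (e : E) (o a₁ a₂ b : V)
    (h0 : 0 < massQ (Function.update p e 0) ends a₁ a₂)
    (h1 : 0 < massQ (Function.update p e 1) ends a₁ a₂) :
    R1 p ends e o a₁ a₂ b ↔
      massA (Function.update p e 1) ends o a₁ a₂ b / massQ (Function.update p e 1) ends a₁ a₂ -
          massF (Function.update p e 0) ends a₁ a₂ b / massQ (Function.update p e 0) ends a₁ a₂ *
            (massG (Function.update p e 1) ends o a₁ a₂ /
              massQ (Function.update p e 1) ends a₁ a₂) -
          massG (Function.update p e 0) ends o a₁ a₂ / massQ (Function.update p e 0) ends a₁ a₂ *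
            (massF (Function.update p e 1) ends a₁ a₂ b /
              massQ (Function.update p e 1) ends a₁ a₂) +
          massF (Function.update p e 0) ends a₁ a₂ b / massQ (Function.update p e 0) ends a₁ a₂ *
            (massG (Function.update p e 0) ends o a₁ a₂ /
              massQ (Function.update p e 0) ends a₁ a₂) ≤ 0 := by
  unfold R1
  set P0 := massQ (Function.update p e 0) ends a₁ a₂ with hP0
  set P1 := massQ (Function.update p e 1) ends a₁ a₂ with hP1
  set A1 := massA (Function.update p e 1) ends o a₁ a₂ b
  set F0 := massF (Function.update p e 0) ends a₁ a₂ b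
  set F1 := massF (Function.update p e 1) ends a₁ a₂ b
  set G0 := massG (Function.update p e 0) ends o a₁ a₂
  set G1 := massG (Function.update p e 1) ends o a₁ a₂
  have hP0' : P0 ≠ 0 := h0.ne'
  have hP1' : P1 ≠ 0 := h1.ne'
  have hpos : 0 < P1 * P0 ^ 2 := mul_pos h1 (pow_pos h0 2)
  have key : A1 / P1 - F0 / P0 * (G1 / P1) - G0 / P0 * (F1 / P1) + F0 / P0 * (G0 / P0) =
      (A1 * P0 ^ 2 + F0 * G0 * P1 - P0 * (F1 * G0 + F0 * G1)) / (P1 * P0 ^ 2) := by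
    field_simp
    ring
  rw [key, div_nonpos_iff]
  constructor
  · intro h
    right
    exact ⟨by linarith, hpos.le⟩
  · rintro (⟨_, h⟩ | ⟨h, _⟩)
    · exact absurd h (not_le.2 hpos)
    · linarith

end Equivalences

end R1Rung

end Summit.Ventures.PercRepro2
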